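import Mathlib.RingTheory.Nullstellensatz
import Mathlib.Algebra.MvPolynomial.Funext
import Mathlib.FieldTheory.IsAlgClosed.Basic
import Mathlib.Algebra.Field.ZMod
import HarnessLib

/-!
# A correspondence meets the graph of every large power of Frobenius (Hrushovski; Varshavsky 2014)

Topic `Literature/AlgebraicGeometry/FiniteFields` (item `wi-34119`; wanted as an explicit hypothesis
by the provers of the support item `ClosingLemma` (stmt-ResolutionOfSingularities-16348) and of the
crux `ClosingReduction` (stmt-ResolutionOfSingularities-16347) of route
`ResolutionOfSingularities/FrobeniusClosing`). Source read: Y. Varshavsky, *Intersection of a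
correspondence with a graph of Frobenius*, arXiv:1405.6381v3 (21 May 2015), pp. 1–2 (published as
J. Algebraic Geom. 27 (2018) 1–20), verbatim:

> Let `𝔽_q` be a finite field, `𝔽` an algebraic closure of `𝔽_q`, and `X⁰` a scheme of finite type
> over `𝔽`, defined over `𝔽_q`. We denote by `φ_q = φ_{X⁰,q} : X⁰ → X⁰` the geometric Frobenius
> morphism over `𝔽_q`, and by `Γ⁰_{qⁿ} ⊂ X⁰ × X⁰` the graph of `φ_{qⁿ} = (φ_q)ⁿ`, where the product
> here and later is taken over `𝔽`. Explicitly, `Γ⁰_{qⁿ}` is the image of the morphism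
> `(Id, φ_{qⁿ}) : X⁰ → X⁰ × X⁰`.
> **Theorem 0.1.** Let `c⁰ = (c⁰₁, c⁰₂) : C⁰ → X⁰ × X⁰` be a morphism of schemes of finite type over
> `𝔽` such that `X⁰` and `C⁰` be irreducible, both `c⁰₁` and `c⁰₂` are dominant, and `X⁰` is defined
> over `𝔽_q`. Then for every sufficiently large `n`, the preimage `(c⁰)⁻¹(Γ⁰_{qⁿ})` is non-empty.
> **Corollary 0.2.** In the assumptions of Theorem 0.1, the union `∪ₙ (c⁰)⁻¹(Γ⁰_{qⁿ})` is Zariski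
> dense in `C⁰`.

(Proof of Cor. 0.2 as printed: if the closure `Z` of the union were not `C⁰`, apply Thm. 0.1 to the
restriction of `c⁰` to the dense open `C⁰ ∖ Z`.) Varshavsky, p. 1: "a short geometric proof of the
following theorem of Hrushovski [Hr, Cor 1.2]"; Hrushovski's statement (arXiv:math/0406514,
Cor. 1.2, verbatim): "Let `X` be an affine variety over `k = GF(q)`, and let `S ⊂ X²` be an
irreducible subvariety over `Kᵃ`. Assume the two projections `S → X` are dominant. Then for any
proper subvariety `W` of `X`, for large enough `m`, there exist `x ∈ X(kᵃ)` with
`(x, φ_q^m(x)) ∈ S` and `x ∉ W`." A third proof, with the point count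
`#(c⁰)⁻¹(Γ_{qⁿ})(k) = (deg c₁ / deg(c₂)_insep) q^{n dim C⁰} + O(q^{n (dim C⁰ - 1/2)})`, is
Shuddhodan–Varshavsky [ShuddhodanVarshavsky2022].

## Lean rendering — the affine, embedded instance of Theorem 0.1, nothing beyond it

Mathlib has no geometric Frobenius of an `𝔽̄_q`-scheme with an `𝔽_q`-structure, and the requesting
route works with polynomial zero sets in `Kᴺ × Kᴺ` over fields `K ⊇ ℤ/p`, so the fact below is the
instance of Theorem 0.1 in which `X⁰ ⊆ 𝔸ᴺ` is closed and `C⁰ ⊆ 𝔸ᴺ × 𝔸ᴺ` is locally closed, written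
in the vocabulary of `Mathlib.RingTheory.Nullstellensatz` (`MvPolynomial.zeroLocus`,
`MvPolynomial.vanishingIdeal`):

* `𝔽 = K` is an algebraic closure of `ℤ/p` (`[IsAlgClosure (ZMod p) K]`), `q = pᵃ` with `a ≥ 1`, and
  `𝔽_q = {c ∈ K : c^q = c}` is the subfield of `K` with `q` elements, of which `K` is an algebraic
  closure.
* `X⁰ ⊆ 𝔸ᴺ_K` is the closed subscheme cut out by a set `S₀` of polynomials ALL OF WHOSE COEFFICIENTS
  LIE IN `𝔽_q` (`coeff m f ^ q = coeff m f`) — this is "`X⁰` is defined over `𝔽_q`"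
  (`X⁰ = Spec (𝔽_q[X]/(S₀)) ⊗_{𝔽_q} K`). Its `K`-points are `zeroLocus K (Ideal.span S₀) ⊆ Kᴺ`;
  its geometric `qⁿ`-Frobenius acts on them by `x ↦ x^{(qⁿ)} := (xᵢ^{qⁿ})ᵢ`, so the `K`-points of
  `Γ⁰_{qⁿ}` are the points `(x, x^{(qⁿ)}) = frobGraphPt (q ^ n) x`, `x ∈ X⁰(K)`.
* `C⁰ = V(P) ∖ V(g) ⊆ 𝔸ᴺ × 𝔸ᴺ` for a PRIME ideal `P ⊆ K[X, Y] = MvPolynomial (Fin N ⊕ Fin N) K`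
  (first factor `X = Sum.inl`, second factor `Y = Sum.inr`) and a polynomial `g ∉ P`, with the
  reduced structure `Spec (K[X,Y]/P)_g`: a non-empty open subscheme of the integral scheme `V(P)`,
  hence irreducible; `c⁰` is the inclusion. (`g = 1` is the closed case `C⁰ = V(P)`.)
* "`c⁰` lands in `X⁰ × X⁰` and `c⁰₁`, `c⁰₂` are dominant" is the pair of equalities
  `P ∩ K[X] = I(X⁰(K))` and `P ∩ K[Y] = I(X⁰(K))`, in Lean
  `Ideal.comap (rename Sum.inl) P = vanishingIdeal K (zeroLocus K (Ideal.span S₀))` and the same with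
  `Sum.inr`. Indeed `I(X⁰(K)) = √(S₀·K[X])` (Nullstellensatz) is the nilradical of `K[X]/(S₀)`
  pulled back to `K[X]`, and `P ∩ K[X]` is the kernel of `K[X] → (K[X,Y]/P)_g`; "`⊇`" says that
  `c⁰₁` maps `C⁰` into `X⁰` (`S₀ ↦ 0`), and "`⊆`" that the kernel of `𝒪(X⁰) → 𝒪(C⁰)` is nil, i.e.
  that `c⁰₁` is dominant (`Spec B → Spec A` is dominant iff `ker (A → B) ⊆ nil A`).
  Set-theoretically: the Zariski closure of `pr₁(C⁰(K))` is exactly `X⁰(K)`. The equality forces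
  `I(X⁰(K))` to be prime (a contraction of the prime `P`), i.e. `X⁰` irreducible, as Theorem 0.1
  requires; `X⁰` need not be reduced (Theorem 0.1 does not ask it to be).
* Conclusion: `(c⁰)⁻¹(Γ⁰_{qⁿ})`, a scheme of finite type over the algebraically closed field `K`, is
  non-empty iff it has a `K`-point, i.e. iff some `x ∈ Kᴺ` has `(x, x^{(qⁿ)}) ∈ V(P)` and
  `g(x, x^{(qⁿ)}) ≠ 0`; "for every sufficiently large `n`" is `∃ n₀, ∀ n ≥ n₀`.

Proved here FROM the fact (no further hypotheses): the case `X⁰ = 𝔸ᴺ` (`S₀ = ∅`, where dominance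
reads `P ∩ K[X] = 0 = P ∩ K[Y]`), which is the form the route asked for, and Corollary 0.2 by the
printed argument (Zariski density of `⋃_{n ≥ 1} (c⁰)⁻¹(Γ⁰_{qⁿ})` in `V(P)`: a polynomial vanishing
at every point `(x, x^{(qⁿ)}) ∈ V(P)`, `n ≥ 1`, lies in `P = I(V(P))`).

NOT vendored: Theorem 0.1 for non-affine / non-embedded `X⁰`, `C⁰`; Cor. 0.3–0.4 (quasi-fixed and
periodic points of a dominant self-map are Zariski dense, cf. [Fakhruddin2002]); the quantitative
estimates of Hrushovski (Thm. 1.1) and of [ShuddhodanVarshavsky2022].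

## References

* [Varshavsky2014] Y. Varshavsky, Intersection of a correspondence with a graph of Frobenius,
  arXiv:1405.6381 (J. Algebraic Geom. 27 (2018) 1–20), Thm. 0.1 and Cor. 0.2 (pp. 1–2 of v3).
* [Hrushovski2004] E. Hrushovski, The elementary theory of the Frobenius automorphisms,
  arXiv:math/0406514, Cor. 1.2.
* [ShuddhodanVarshavsky2022] K. V. Shuddhodan, Y. Varshavsky, The Hrushovski–Lang–Weil estimates,
  Algebr. Geom. 9 (2022) 651–687.
-/

noncomputable section

open MvPolynomial

namespace Literature.AlgebraicGeometry.FiniteFields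

variable {K : Type*} {N : ℕ}

/-- The point `(x, x^{(m)})` of `Kᴺ × Kᴺ = K^{N ⊕ N}`, where `x^{(m)} = (xᵢ^m)ᵢ`. For `K` an
algebraic closure of `𝔽_q` and `m = qⁿ` these are exactly the `K`-points of the graph
`Γ_{qⁿ} ⊆ 𝔸ᴺ × 𝔸ᴺ` of the geometric `qⁿ`-Frobenius of `𝔸ᴺ` (which raises the coordinates of a
`K`-point to the `qⁿ`-th power), and, for `x ∈ X⁰(K)`, the `K`-points of the graph `Γ⁰_{qⁿ}` of
`φ_{X⁰,qⁿ}` for every closed `X⁰ ⊆ 𝔸ᴺ` defined over `𝔽_q` ("`Γ⁰_{qⁿ}` is the image of the morphism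
`(Id, φ_{qⁿ}) : X⁰ → X⁰ × X⁰`"). [cite: Varshavsky2014, Introduction, p. 1] -/
def frobGraphPt [Monoid K] (m : ℕ) (x : Fin N → K) : Fin N ⊕ Fin N → K :=
  Sum.elim x fun i => x i ^ m

/-- First block of coordinates of `(x, x^{(m)})` is `x`. [cite: Varshavsky2014, Introduction, p. 1] -/
@[simp] theorem frobGraphPt_inl [Monoid K] (m : ℕ) (x : Fin N → K) (i : Fin N) :
    frobGraphPt m x (Sum.inl i) = x i := rfl

/-- Second block of coordinates of `(x, x^{(m)})` is `x^{(m)}`.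
[cite: Varshavsky2014, Introduction, p. 1] -/
@[simp] theorem frobGraphPt_inr [Monoid K] (m : ℕ) (x : Fin N → K) (i : Fin N) :
    frobGraphPt m x (Sum.inr i) = x i ^ m := rfl

/-- `pr₁ (x, x^{(m)}) = x`. [cite: Varshavsky2014, Introduction, p. 1] -/
theorem frobGraphPt_comp_inl [Monoid K] (m : ℕ) (x : Fin N → K) :
    frobGraphPt m x ∘ Sum.inl = x := rfl

/-- `pr₂ (x, x^{(m)}) = x^{(m)}`. [cite: Varshavsky2014, Introduction, p. 1] -/
theorem frobGraphPt_comp_inr [Monoid K] (m : ℕ) (x : Fin N → K) :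
    frobGraphPt m x ∘ Sum.inr = fun i => x i ^ m := rfl

/-- `(x, x^{(m)})` is literally the pair `Sum.elim x x^{(m)}` (the shape of the points of a path in
route `FrobeniusClosing`). [cite: Varshavsky2014, Introduction, p. 1] -/
theorem frobGraphPt_eq_sumElim [Monoid K] (m : ℕ) (x : Fin N → K) :
    frobGraphPt m x = Sum.elim x (fun i => x i ^ m) := rfl

/-- **Hrushovski's theorem in Varshavsky's form — a correspondence with dominant projections meets the
graph of every sufficiently large power of Frobenius; affine embedded instance of
[Varshavsky2014, Thm. 0.1] (= [Hrushovski2004, Cor. 1.2]).** Printed statement: `𝔽_q` a finite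
field, `𝔽` an algebraic closure of `𝔽_q`, `X⁰` a scheme of finite type over `𝔽` defined over `𝔽_q`,
`φ_q : X⁰ → X⁰` its geometric Frobenius over `𝔽_q`, `Γ⁰_{qⁿ} ⊂ X⁰ × X⁰` the graph of `(φ_q)ⁿ`;
"Let `c⁰ = (c⁰₁, c⁰₂) : C⁰ → X⁰ × X⁰` be a morphism of schemes of finite type over `𝔽` such that
`X⁰` and `C⁰` be irreducible, both `c⁰₁` and `c⁰₂` are dominant, and `X⁰` is defined over `𝔽_q`.
Then for every sufficiently large `n`, the preimage `(c⁰)⁻¹(Γ⁰_{qⁿ})` is non-empty."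

Rendering (see the module docstring): `K = 𝔽` an algebraic closure of `ℤ/p`, `q = pᵃ` (`a ≥ 1`),
`𝔽_q = {c ∈ K : c^q = c}`; `X⁰ = V(S₀) ⊆ 𝔸ᴺ` for a set `S₀` of polynomials with all coefficients in
`𝔽_q` (so `X⁰` is defined over `𝔽_q`), with `K`-points `zeroLocus K (Ideal.span S₀)`;
`C⁰ = V(P) ∖ V(g) ⊆ 𝔸ᴺ × 𝔸ᴺ` with `P ⊆ K[X,Y]` prime and `g ∉ P` (irreducible and non-empty),
`c⁰` the inclusion; "`c⁰(C⁰) ⊆ X⁰ × X⁰` with `c⁰₁`, `c⁰₂` dominant" is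
`P ∩ K[X] = I(X⁰(K)) = P ∩ K[Y]` (which also makes `X⁰` irreducible); the `K`-points of `Γ⁰_{qⁿ}`
are the `frobGraphPt (q ^ n) x`; non-emptiness of the finite-type `K`-scheme `(c⁰)⁻¹(Γ⁰_{qⁿ})` is
the existence of a `K`-point `(x, x^{(qⁿ)}) ∈ V(P)` with `g (x, x^{(qⁿ)}) ≠ 0`. Statement only
(proof, §§1–5 of the source: reduction to `c⁰` a closed embedding with `dim C⁰ = dim X⁰`, a
compactification whose boundary is made locally `c^{(m)}`-invariant by a blow-up, de Jong
alterations, Pink's blow-up `Bl_{⋃(Xᵢ × Xᵢ)}(X × X)`, and the intersection number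
`[C̃]·[Γ̃_{qⁿ}] ~ deg(c₁) q^{dn} ≠ 0` via the Lefschetz trace formula and Deligne's purity).
[cite: Varshavsky2014, Thm. 0.1] -/
def Varshavsky2014TwistedLangWeil : Prop :=
  ∀ (p : ℕ) [Fact p.Prime] (K : Type) [Field K] [Algebra (ZMod p) K] [IsAlgClosure (ZMod p) K]
    (a N : ℕ) (S₀ : Set (MvPolynomial (Fin N) K)) (P : Ideal (MvPolynomial (Fin N ⊕ Fin N) K))
    (g : MvPolynomial (Fin N ⊕ Fin N) K),
    0 < a →
    (∀ f ∈ S₀, ∀ m : Fin N →₀ ℕ, coeff m f ^ (p ^ a) = coeff m f) →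
    P.IsPrime →
    Ideal.comap (rename Sum.inl) P = vanishingIdeal K (zeroLocus K (Ideal.span S₀)) →
    Ideal.comap (rename Sum.inr) P = vanishingIdeal K (zeroLocus K (Ideal.span S₀)) →
    g ∉ P →
      ∃ n₀ : ℕ, ∀ n : ℕ, n₀ ≤ n → ∃ x : Fin N → K,
        frobGraphPt ((p ^ a) ^ n) x ∈ zeroLocus K P ∧
          aeval (frobGraphPt ((p ^ a) ^ n) x) g ≠ 0

/-- **[Varshavsky2014, Cor. 0.2] (affine embedded instance), proved from Thm. 0.1 by the printed
argument.** "In the assumptions of Theorem 0.1, the union `∪ₙ (c⁰)⁻¹(Γ⁰_{qⁿ})` is Zariski dense in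
`C⁰`." Rendering, for the closed correspondence `C⁰ = V(P)` (hypotheses as in
`Varshavsky2014TwistedLangWeil`): a polynomial `g ∈ K[X,Y]` vanishing at every point
`(x, x^{(qⁿ)}) ∈ V(P)`, `n ≥ 1`, lies in `P` (`= I(V(P))`, `P` being prime), i.e. the Zariski
closure of `⋃_{n ≥ 1} V(P) ∩ Γ_{qⁿ}` is `V(P)`. Proof as printed: otherwise Thm. 0.1 applied to the
open `V(P) ∖ V(g)` yields such a point with `g ≠ 0`. [cite: Varshavsky2014, Cor. 0.2] -/
theorem Varshavsky2014TwistedLangWeil.density (h : Varshavsky2014TwistedLangWeil)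
    (p : ℕ) [Fact p.Prime] (K : Type) [Field K] [Algebra (ZMod p) K] [IsAlgClosure (ZMod p) K]
    (a N : ℕ) (S₀ : Set (MvPolynomial (Fin N) K)) (P : Ideal (MvPolynomial (Fin N ⊕ Fin N) K))
    (ha : 0 < a) (hS₀ : ∀ f ∈ S₀, ∀ m : Fin N →₀ ℕ, coeff m f ^ (p ^ a) = coeff m f)
    (hP : P.IsPrime)
    (h₁ : Ideal.comap (rename Sum.inl) P = vanishingIdeal K (zeroLocus K (Ideal.span S₀)))
    (h₂ : Ideal.comap (rename Sum.inr) P = vanishingIdeal K (zeroLocus K (Ideal.span S₀)))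
    (g : MvPolynomial (Fin N ⊕ Fin N) K)
    (hg : ∀ n : ℕ, 0 < n → ∀ x : Fin N → K, frobGraphPt ((p ^ a) ^ n) x ∈ zeroLocus K P →
      aeval (frobGraphPt ((p ^ a) ^ n) x) g = 0) :
    g ∈ P := by
  by_contra hgP
  obtain ⟨n₀, hn₀⟩ := h p K a N S₀ P g ha hS₀ hP h₁ h₂ hgP
  obtain ⟨x, hx, hgx⟩ := hn₀ (n₀ + 1) (Nat.le_succ n₀)
  exact hgx (hg (n₀ + 1) (Nat.succ_pos n₀) x hx)

/-- Over an infinite field `K`, the only polynomial vanishing on all of `Kᴺ = V(∅)` is `0`: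
`I(𝔸ᴺ(K)) = 0`. [folklore] -/
theorem vanishingIdeal_zeroLocus_span_empty (K : Type*) [Field K] [Infinite K] (N : ℕ) :
    vanishingIdeal K (zeroLocus K (Ideal.span (∅ : Set (MvPolynomial (Fin N) K)))) = ⊥ := by
  rw [Ideal.span_empty, zeroLocus_bot]
  refine eq_bot_iff.2 fun f hf => ?_
  rw [mem_vanishingIdeal_iff] at hf
  rw [Ideal.mem_bot]
  refine MvPolynomial.funext fun x => ?_
  have hfx := hf x trivial
  rw [aeval_eq_eval] at hfx
  simpa using hfx

/-- **[Varshavsky2014, Thm. 0.1] for `X⁰ = 𝔸ᴺ` — the form requested by route `FrobeniusClosing`.**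
`K` an algebraic closure of `ℤ/p`, `q = pᵃ` (`a ≥ 1`), `C⁰ = V(P) ∖ V(g) ⊆ 𝔸ᴺ × 𝔸ᴺ` with `P` prime,
`g ∉ P`, and both projections `V(P) → 𝔸ᴺ` dominant, i.e. `P` contains no non-zero polynomial in the
`X`-variables alone and none in the `Y`-variables alone (`P ∩ K[X] = 0 = P ∩ K[Y]`). Then for every
sufficiently large `n` there is `x ∈ Kᴺ` with `(x, x^{(qⁿ)}) ∈ V(P)` and `g(x, x^{(qⁿ)}) ≠ 0`.
Derived from `Varshavsky2014TwistedLangWeil` with `S₀ = ∅` (`I(𝔸ᴺ(K)) = 0`, `K` being infinite).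
[cite: Varshavsky2014, Thm. 0.1] -/
theorem Varshavsky2014TwistedLangWeil.affineSpace (h : Varshavsky2014TwistedLangWeil)
    (p : ℕ) [Fact p.Prime] (K : Type) [Field K] [Algebra (ZMod p) K] [IsAlgClosure (ZMod p) K]
    (a N : ℕ) (P : Ideal (MvPolynomial (Fin N ⊕ Fin N) K)) (ha : 0 < a) (hP : P.IsPrime)
    (h₁ : ∀ f : MvPolynomial (Fin N) K, rename Sum.inl f ∈ P → f = 0)
    (h₂ : ∀ f : MvPolynomial (Fin N) K, rename Sum.inr f ∈ P → f = 0)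
    (g : MvPolynomial (Fin N ⊕ Fin N) K) (hg : g ∉ P) :
    ∃ n₀ : ℕ, ∀ n : ℕ, n₀ ≤ n → ∃ x : Fin N → K,
      frobGraphPt ((p ^ a) ^ n) x ∈ zeroLocus K P ∧
        aeval (frobGraphPt ((p ^ a) ^ n) x) g ≠ 0 := by
  haveI : IsAlgClosed K := IsAlgClosure.isAlgClosed (ZMod p)
  have hbot := vanishingIdeal_zeroLocus_span_empty K N
  refine h p K a N ∅ P g ha (fun f hf => (Set.notMem_empty f hf).elim) hP ?_ ?_ hg
  · rw [hbot]
    refine eq_bot_iff.2 fun f hf => ?_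
    rw [Ideal.mem_bot]
    exact h₁ f (Ideal.mem_comap.1 hf)
  · rw [hbot]
    refine eq_bot_iff.2 fun f hf => ?_
    rw [Ideal.mem_bot]
    exact h₂ f (Ideal.mem_comap.1 hf)

/-- **[Varshavsky2014, Cor. 0.2] for `X⁰ = 𝔸ᴺ`.** With `K`, `q = pᵃ`, `P` prime and
`P ∩ K[X] = 0 = P ∩ K[Y]` as in `Varshavsky2014TwistedLangWeil.affineSpace`: the points
`(x, x^{(qⁿ)}) ∈ V(P)`, `n ≥ 1`, are Zariski dense in `V(P)` — every polynomial vanishing at all of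
them lies in `P`. [cite: Varshavsky2014, Cor. 0.2] -/
theorem Varshavsky2014TwistedLangWeil.affineSpace_density (h : Varshavsky2014TwistedLangWeil)
    (p : ℕ) [Fact p.Prime] (K : Type) [Field K] [Algebra (ZMod p) K] [IsAlgClosure (ZMod p) K]
    (a N : ℕ) (P : Ideal (MvPolynomial (Fin N ⊕ Fin N) K)) (ha : 0 < a) (hP : P.IsPrime)
    (h₁ : ∀ f : MvPolynomial (Fin N) K, rename Sum.inl f ∈ P → f = 0)
    (h₂ : ∀ f : MvPolynomial (Fin N) K, rename Sum.inr f ∈ P → f = 0)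
    (g : MvPolynomial (Fin N ⊕ Fin N) K)
    (hg : ∀ n : ℕ, 0 < n → ∀ x : Fin N → K, frobGraphPt ((p ^ a) ^ n) x ∈ zeroLocus K P →
      aeval (frobGraphPt ((p ^ a) ^ n) x) g = 0) :
    g ∈ P := by
  by_contra hgP
  obtain ⟨n₀, hn₀⟩ := h.affineSpace p K a N P ha hP h₁ h₂ g hgP
  obtain ⟨x, hx, hgx⟩ := hn₀ (n₀ + 1) (Nat.le_succ n₀)
  exact hgx (hg (n₀ + 1) (Nat.succ_pos n₀) x hx)

end Literature.AlgebraicGeometry.FiniteFields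

end
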